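import Literature.AlgebraicGeometry.Resolution.BlowupStalkCharts
import Literature.AlgebraicGeometry.Resolution.BlowupsScaling
import Literature.AlgebraicGeometry.Resolution.BlowupRegularPairCharts
import Literature.AlgebraicGeometry.Resolution.AdicCompletionRegular
import Summits.ResolutionOfSingularities.ResolutionOfSingularities.Theorems.FrobeniusLadderFInjectiveMacaulayficationFedderClosure
import Summits.ResolutionOfSingularities.ResolutionOfSingularities.Theorems.FrobeniusLadderFInjectiveMacaulayficationTauFloorOneCIChartCM
import Summits.ResolutionOfSingularities.ResolutionOfSingularities.Theorems.FrobeniusLadderFInjectiveMacaulayficationFiLocusOpenOfAffine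
import Summits.ResolutionOfSingularities.ResolutionOfSingularities.Theorems.FrobeniusLadderFInjectiveMacaulayficationSliceableCentre
import Mathlib.RingTheory.RegularLocalRing.Polynomial
import Mathlib.AlgebraicGeometry.FunctionField
import HarnessLib

/-!
# The stalks of a blowing up along `γ·(a, b)`, `(a, b)` a regular pair of a regular local ring, are Cohen–Macaulay
# (BED Ω global patch F4(c): the GLUE as a generic per-stalk theorem — no chart tables, no restriction to affine opens)

[OURS · L1 W4.5a] Support file (`--supports stmt-ResolutionOfSingularities-15315 --as helper`); theorems only; unconditional; ANY field /
ANY integral base scheme. Nothing of the crux is proved; no census.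

For a blowing up `π : X′ → X` (`IsBlowup π J`) of an integral scheme, a point `x′` with `R := 𝒪_{X,π x′}` REGULAR, and
`J_{π x′} = γ·(c₀, c₁)` with `γ ≠ 0`, `cᵢ ≠ 0` and `(c₀, c₁)` weakly regular on `R`, the local ring `𝒪_{X′,x′}` satisfies the CM
clause `CMCl` (★★ `cmCl_stalk_of_isBlowup_pair`). Chain: blowing ups commute with the flat base change `Spec R → X` and the scaling
`γ` does not change the blowing up (Literature `IsBlowup.pullback_snd_of_flat`, `IsBlowup.of_span_singleton_mul`) ⇒ `𝒪_{X′,x′}` is a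
localisation of a chart ring `(R[(c)t])_{(c_j t)}` (`exists_reesChart_stalk_of_span_singleton_mul`, the Literature
`IsBlowup.exists_chart_morphism` with the scaling step inserted) `≅ R[(c)/c_j] ≅ R[T]/(c_j T − c_{j′})` (Stacks 0804/0BIQ: Literature
`reesChartEquiv`, `ringEquiv_quotient_blowupAlgebra_pair`) — a HYPERSURFACE in the regular ring `R[T]` (Mathlib
`Polynomial.isRegularRing_of_isRegularRing`), whose localisations are CM (✓ `Fedder.sop_isWeaklyRegular_quotient` + ✓
`TauFloorOneCIChartCM.exists_quotLocalizationEquiv`).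
* §1 `cmCl_localization_quotient_principal`, `cmCl_of_isLocalization_quotient_principal` — hypersurfaces in regular rings are CM at every prime;
* §2 `pair_of_isWeaklyRegular`, `rel_pair_ne_zero`, ★ `cmCl_of_isLocalization_chartRing_pair` — every local ring of a chart of `Bl_{(c₀,c₁)} Spec R`;
* §3 `exists_chart_morphism_of_span_singleton_mul`, `exists_reesChart_stalk_of_span_singleton_mul`, ★★ `cmCl_stalk_of_isBlowup_pair`.
Consumer (g14, F4(c) of the Ω₁ floor `S′ → X̃` along `𝒥 = (λ, g)`): per point `x̃`, `𝒥_x̃ = γ·(a′, b′)` from the ✓p703845 letters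
(`γ = y^G`, `a′ = y^{M₁}`, `b′ = y^{M₂}χ` coprime in the UFD `𝒪_{X̃,x̃}` ⇒ weakly regular), `X̃` regular at `x̃` ⇒ `CMCl 𝒪_{S′,x′}`.
[cite: StacksProject, Tag 0804, Tag 0805, Tag 0BIQ; Matsumura1987, Thm. 17.4 (iii), Thm. 19.3; Villamayoru2006, proof of Thm. 3.3]
-/

-- single-problem summit: the doubled namespace component is forced
set_option linter.dupNamespace false

noncomputable section

open CategoryTheory CategoryTheory.Limits AlgebraicGeometry TopologicalSpace IsLocalRing
open Literature.AlgebraicGeometry.Resolution RingTheory.Sequence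

namespace Summit.ResolutionOfSingularities.ResolutionOfSingularities.Theorems.FInjectiveMacaulayfication.BlowupPairStalkCM

open Summit.ResolutionOfSingularities.ResolutionOfSingularities.Theorems.FInjectiveMacaulayfication SliceableCentre

/-! ## §1 Hypersurfaces in regular rings are CM at every prime -/

section Hypersurface

variable {P : Type} [CommRing P] [IsRegularRing P] [IsDomain P]

/-- **`(P/(f))_Q` satisfies the CM clause** for `P` a regular domain (all `P_𝔮` regular local), `f ≠ 0`, `Q` any prime of `P/(f)`:
`P_{Q′}` regular local, `P_{Q′}/(f)` CM (✓ `Fedder.sop_isWeaklyRegular_quotient`), `≅ (P/(f))_Q`. [cite: Matsumura1987, Thm. 17.4 (iii)] -/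
theorem cmCl_localization_quotient_principal (I : Ideal P) (f : P) (hI : I = Ideal.span {f}) (hf : f ≠ 0)
    (Q : Ideal (P ⧸ I)) [Q.IsPrime] : CMCl (Localization.AtPrime Q) := by
  subst hI
  haveI : IsRegularLocalRing (Localization.AtPrime (Q.comap (Ideal.Quotient.mk (Ideal.span {f})))) :=
    IsRegularRing.isRegularLocalRing_localization _
  have hinj : Function.Injective (algebraMap P (Localization.AtPrime (Q.comap (Ideal.Quotient.mk (Ideal.span {f}))))) :=
    IsLocalization.injective _ (Q.comap (Ideal.Quotient.mk (Ideal.span {f}))).primeCompl_le_nonZeroDivisors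
  have hfQ' : f ∈ Q.comap (Ideal.Quotient.mk (Ideal.span {f})) := by
    rw [Ideal.mem_comap, Ideal.Quotient.eq_zero_iff_mem.mpr (Ideal.mem_span_singleton_self f)]
    exact Q.zero_mem
  have hfm : algebraMap P (Localization.AtPrime (Q.comap (Ideal.Quotient.mk (Ideal.span {f})))) f ∈
      maximalIdeal (Localization.AtPrime (Q.comap (Ideal.Quotient.mk (Ideal.span {f})))) := by
    rw [← Localization.AtPrime.map_eq_maximalIdeal]; exact Ideal.mem_map_of_mem _ hfQ'
  have hf0 : algebraMap P (Localization.AtPrime (Q.comap (Ideal.Quotient.mk (Ideal.span {f})))) f ≠ 0 := fun h =>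
    hf (hinj (by rw [h, map_zero]))
  have hmap : (Ideal.span {f}).map (algebraMap P (Localization.AtPrime (Q.comap (Ideal.Quotient.mk (Ideal.span {f}))))) =
      Ideal.span {algebraMap P (Localization.AtPrime (Q.comap (Ideal.Quotient.mk (Ideal.span {f})))) f} := by
    rw [Ideal.map_span, Set.image_singleton]
  have hCM : CMCl (Localization.AtPrime (Q.comap (Ideal.Quotient.mk (Ideal.span {f}))) ⧸
      (Ideal.span {f}).map (algebraMap P (Localization.AtPrime (Q.comap (Ideal.Quotient.mk (Ideal.span {f})))))) := by
    rw [hmap]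
    exact fun d hd s hs => Fedder.sop_isWeaklyRegular_quotient hfm hf0 d hd s hs
  obtain ⟨e⟩ := TauFloorOneCIChartCM.exists_quotLocalizationEquiv (Ideal.span {f}) Q
  exact FiLocusOpenOfAffine.cmClause_of_ringEquiv e hCM

/-- The same for ANY localisation `S` of `P/(f)` at `Q`. [cite: Matsumura1987, Thm. 17.4 (iii)] -/
theorem cmCl_of_isLocalization_quotient_principal (I : Ideal P) (f : P) (hI : I = Ideal.span {f}) (hf : f ≠ 0)
    (Q : Ideal (P ⧸ I)) [Q.IsPrime] (S : Type) [CommRing S] [Algebra (P ⧸ I) S] [IsLocalization.AtPrime S Q] : CMCl S :=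
  FiLocusOpenOfAffine.cmClause_of_ringEquiv (IsLocalization.algEquiv Q.primeCompl (Localization.AtPrime Q) S).toRingEquiv
    (cmCl_localization_quotient_principal I f hI hf Q)

end Hypersurface

/-! ## §2 Every local ring of a chart of `Bl_{(c₀, c₁)} Spec R` is CM (`R` regular local, `(c₀, c₁)` weakly regular) -/

section ChartPair

variable {R : Type} [CommRing R]

omit [CommRing R] in
/-- `range c = {c 0, c 1}` for `c : Fin 2 → R`. [plumbing] -/
theorem range_fin_two (c : Fin 2 → R) : Set.range c = {c 0, c 1} := by
  ext x
  simp only [Set.mem_range, Set.mem_insert_iff, Set.mem_singleton_iff, Fin.exists_fin_two, eq_comm]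

/-- `(c_j, c_{j′}) = (c)` for the two indices of `Fin 2`. [plumbing] -/
theorem span_pair_eq_span_range (c : Fin 2 → R) {j j' : Fin 2} (hjj' : j' ≠ j) :
    Ideal.span {c j, c j'} = Ideal.span (Set.range c) := by
  rw [range_fin_two]
  fin_cases j <;> fin_cases j' <;> first | exact absurd rfl hjj' | rfl | exact congrArg _ (Set.pair_comm _ _)

/-- The relation `c_j·T − c_{j′}` is a nonzero polynomial when `c_j ≠ 0`. [plumbing] -/
theorem rel_pair_ne_zero {u : R} (hu : u ≠ 0) (v : R) : Polynomial.C u * Polynomial.X - Polynomial.C v ≠ 0 := by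
  intro h
  apply hu
  have h1 := congrArg (fun q : Polynomial R => q.coeff 1) h
  simp only [Polynomial.coeff_sub, Polynomial.coeff_C_mul, Polynomial.coeff_X_one, mul_one, Polynomial.coeff_C,
    one_ne_zero, if_false, sub_zero, Polynomial.coeff_zero] at h1
  exact h1

/-- **A weakly regular pair in the divisibility form** of Stacks 0BIQ: `u` a nonzerodivisor and `u ∣ r·v ⇒ u ∣ r`. [folklore] -/
theorem pair_of_isWeaklyRegular {u v : R} (h : IsWeaklyRegular R [u, v]) :
    u ∈ nonZeroDivisors R ∧ ∀ r : R, u ∣ r * v → u ∣ r := by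
  rw [isWeaklyRegular_cons_iff, isWeaklyRegular_cons_iff] at h
  obtain ⟨hu, hv, -⟩ := h
  refine ⟨?_, fun r hr => ?_⟩
  · refine mem_nonZeroDivisors_iff_right.mpr fun x hx => hu ?_
    change u • x = u • (0 : R)
    rw [smul_eq_mul, smul_eq_mul, mul_zero, mul_comm, hx]
  · obtain ⟨t, ht⟩ := hr
    have h0 : v • (Submodule.Quotient.mk r : QuotSMulTop u R) = 0 := by
      rw [← Submodule.Quotient.mk_smul, Submodule.Quotient.mk_eq_zero]
      exact (Submodule.mem_smul_pointwise_iff_exists _ _ _).2 ⟨t, Submodule.mem_top, by rw [smul_eq_mul, smul_eq_mul, mul_comm v r, ht]⟩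
    have h1 : (Submodule.Quotient.mk r : QuotSMulTop u R) = 0 :=
      hv (by change v • (Submodule.Quotient.mk r : QuotSMulTop u R) = v • (0 : QuotSMulTop u R); rw [h0, smul_zero])
    rw [Submodule.Quotient.mk_eq_zero] at h1
    obtain ⟨y, -, hy⟩ := (Submodule.mem_smul_pointwise_iff_exists _ _ _).1 h1
    exact ⟨y, by rw [← hy, smul_eq_mul]⟩

omit [CommRing R] in
/-- `Submonoid.map e P.primeCompl = (P.comap e⁻¹).primeCompl`. [plumbing; as in Literature `KawasakiBlowupCM`] -/
private theorem primeCompl_map_ringEquiv {A B : Type} [CommRing A] [CommRing B] (e : A ≃+* B) (P : Ideal A) [P.IsPrime] :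
    P.primeCompl.map e = (P.comap e.symm.toRingHom).primeCompl := by
  ext x
  simp only [Submonoid.mem_map, Ideal.mem_primeCompl_iff, Ideal.mem_comap, RingEquiv.toRingHom_eq_coe, RingHom.coe_coe]
  constructor
  · rintro ⟨y, hy, rfl⟩; rwa [e.symm_apply_apply]
  · intro hx; exact ⟨e.symm x, hx, e.apply_symm_apply x⟩

/-- ★ **EVERY LOCAL RING OF A CHART OF `Bl_{(c₀,c₁)} Spec R` IS CM**: `R` regular local, `(c_j, c_{j′})` a regular pair in the 0BIQ
form (`c_j` a nonzerodivisor, `c_j ∣ r·c_{j′} ⇒ c_j ∣ r`), `𝔴` ANY prime of the chart ring `B_j = (R[(c)t])_{(c_j t)}`, `S` a localisation of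
`B_j` at `𝔴` ⇒ `CMCl S` — since `B_j ≅ R[(c)/c_j] ≅ R[T]/(c_j T − c_{j′})` (Literature `reesChartEquiv`, `ringEquiv_quotient_blowupAlgebra_pair`)
is a hypersurface in the regular ring `R[T]`. [cite: StacksProject, Tag 0804, Tag 0BIQ; Matsumura1987, Thm. 17.4 (iii), Thm. 19.3] -/
theorem cmCl_of_isLocalization_chartRing_pair [IsRegularLocalRing R] (c : Fin 2 → R) {j j' : Fin 2} (hjj' : j' ≠ j)
    (hu : c j ∈ nonZeroDivisors R) (huv : ∀ r : R, c j ∣ r * c j' → c j ∣ r)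
    (𝔴 : Ideal (chartRing c j)) [𝔴.IsPrime]
    (S : Type) [CommRing S] [Algebra (chartRing c j) S] [IsLocalization.AtPrime S 𝔴] : CMCl S := by
  haveI : IsDomain R := isDomain_of_isRegularLocalRing R
  haveI : IsRegularRing R := isRegularRing_of_isRegularLocalRing R
  have hu0 : c j ≠ 0 := nonZeroDivisors.ne_zero hu
  -- `θ : R[T]/(c_j T − c_{j′}) ≃ R[(c)/c_j]`
  obtain ⟨θ, -, -⟩ := ringEquiv_quotient_blowupAlgebra_pair (c j) (c j') hu huv
  rw [span_pair_eq_span_range c hjj'] at θ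
  -- `ε : B_j ≃ R[T]/(c_j T − c_{j′})`
  let ε : chartRing c j ≃+* (Polynomial R ⧸ Ideal.span {Polynomial.C (c j) * Polynomial.X - Polynomial.C (c j')}) :=
    (reesChartEquiv (c j) (Ideal.mem_span_range_self (f := c) (x := j))).trans θ.symm
  letI algB : Algebra (Polynomial R ⧸ Ideal.span {Polynomial.C (c j) * Polynomial.X - Polynomial.C (c j')}) S :=
    ((algebraMap (chartRing c j) S).comp ε.symm.toRingHom).toAlgebra
  set 𝔴' : Ideal (Polynomial R ⧸ Ideal.span {Polynomial.C (c j) * Polynomial.X - Polynomial.C (c j')}) :=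
    𝔴.comap ε.symm.toRingHom with h𝔴'
  haveI : 𝔴'.IsPrime := Ideal.comap_isPrime _ 𝔴
  haveI hloc : @IsLocalization.AtPrime _ _ S _ algB 𝔴' _ := by
    have h1 := IsLocalization.isLocalization_of_base_ringEquiv 𝔴.primeCompl S ε
    have h2 : 𝔴.primeCompl.map ε = 𝔴'.primeCompl := primeCompl_map_ringEquiv ε 𝔴
    change IsLocalization 𝔴'.primeCompl S
    rw [← h2]
    exact h1
  exact @cmCl_of_isLocalization_quotient_principal (Polynomial R) _ inferInstance inferInstance
    (Ideal.span {Polynomial.C (c j) * Polynomial.X - Polynomial.C (c j')}) _ rfl (rel_pair_ne_zero hu0 (c j')) 𝔴' _ S _ algB hloc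

end ChartPair

/-! ## §3 The stalks of a blowing up along `γ·(c₀, c₁)` -/

section Stalks

universe u

variable {X' X : Scheme.{u}} {π : X' ⟶ X} {J : X.IdealSheafData}

set_option maxHeartbeats 800000 in
-- the comparison with `Proj` over `Spec 𝒪_{X,s}` elaborates large terms (as in Literature `IsBlowup.exists_chart_morphism`)
/-- **Every point of a blowing up along `γ·(c)` lies on a chart of `Bl_{(c)} Spec 𝒪_{X,s}` computing its local ring** — Literature
`IsBlowup.exists_chart_morphism` with the scaling `γ` removed after the flat base change to `Spec 𝒪_{X,s}` (`IsBlowup.of_span_singleton_mul`).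
[cite: StacksProject, Tag 0804, Tag 0805; Villamayoru2006, proof of Thm. 3.3] -/
theorem exists_chart_morphism_of_span_singleton_mul [IsIntegral X] (hπ : IsBlowup π J) (x' : X') {k : ℕ}
    (c : Fin k → X.presheaf.stalk (π x')) (γ : X.presheaf.stalk (π x')) (hγ : γ ≠ 0) (hc0 : Ideal.span (Set.range c) ≠ ⊥)
    (hc : Ideal.span {γ} * Ideal.span (Set.range c) = stalkIdeal J (π x')) :
    ∃ (j : Fin k) (w : Spec (.of (chartRing c j))) (q : Spec (.of (chartRing c j)) ⟶ X'),
      q w = x' ∧ IsIso (q.stalkMap w) ∧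
        q ≫ π = Spec.map (CommRingCat.ofHom (chartBase c j)) ≫ X.fromSpecStalk (π x') := by
  classical
  have hcj : ∀ j, c j ∈ Ideal.span (Set.range c) := fun j =>
    Ideal.mem_span_range_self (f := c) (x := j)
  haveI : Flat (X.fromSpecStalk (π x')) := flat_fromSpecStalk X (π x')
  -- the base change `P = X' ×_X Spec 𝒪_{X,s} → Spec 𝒪_{X,s}` is a blowing up along `(J_s)~ = (γ·(c))~`, hence along `(c)~`
  have hP : IsBlowup (pullback.snd π (X.fromSpecStalk (π x')))
      (affineBlowup.idealSheaf (Ideal.span (Set.range c))) := by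
    have h := hπ.pullback_snd_of_flat (X.fromSpecStalk (π x'))
    rw [comap_fromSpecStalk_eq_affineBlowupIdealSheaf, ← hc] at h
    exact IsBlowup.of_span_singleton_mul (R := X.presheaf.stalk (π x')) hc0 hγ h
  -- hence isomorphic to `Proj 𝒪_{X,s}[(c) t]` over `Spec 𝒪_{X,s}`
  obtain ⟨e, he, -⟩ := (affineBlowup.isBlowup (Ideal.span (Set.range c))).unique hP
  obtain ⟨y, hy⟩ :=
    mem_range_pullback_fst_fromSpecStalk_of_eq π (π x') (x' := x') rfl
  obtain ⟨z, rfl⟩ : ∃ z, e.hom z = y := ⟨e.inv y, by simp⟩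
  have hz : z ∈ (⊤ : (affineBlowup (Ideal.span (Set.range c))).Opens) := trivial
  rw [← affineBlowup.iSup_chartOpen_eq_top c rfl] at hz
  obtain ⟨j, hzj⟩ := Opens.mem_iSup.mp hz
  obtain ⟨w, -, rfl⟩ := hzj
  refine ⟨j, w, (affineBlowup.chartι (c j) (hcj j) ≫ e.hom) ≫
    pullback.fst π (X.fromSpecStalk (π x')), hy, ?_, ?_⟩
  · have h1 := isIso_stalkMap_pullback_fst_fromSpecStalk π (π x')
      ((affineBlowup.chartι (c j) (hcj j) ≫ e.hom) w)
    haveI : IsOpenImmersion (affineBlowup.chartι (c j) (hcj j) ≫ e.hom) := inferInstance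
    have h2 : IsIso ((affineBlowup.chartι (c j) (hcj j) ≫ e.hom).stalkMap w) := inferInstance
    rw [Scheme.Hom.stalkMap_comp]
    exact @IsIso.comp_isIso _ _ _ _ _ _ _ h1 h2
  · rw [Category.assoc, pullback.condition, Category.assoc, reassoc_of% he, ← Category.assoc,
      affineBlowup.chartι_π (c j) (hcj j)]

/-- **The local rings of a blowing up along `γ·(c)` are localisations of the charts of `Bl_{(c)} Spec 𝒪_{X,s}`** at primes over `𝔪_s`.
[cite: StacksProject, Tag 0804] -/
theorem exists_reesChart_stalk_of_span_singleton_mul [IsIntegral X] (hπ : IsBlowup π J) (x' : X') {k : ℕ}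
    (c : Fin k → X.presheaf.stalk (π x')) (γ : X.presheaf.stalk (π x')) (hγ : γ ≠ 0) (hc0 : Ideal.span (Set.range c) ≠ ⊥)
    (hc : Ideal.span {γ} * Ideal.span (Set.range c) = stalkIdeal J (π x')) :
    ∃ (j : Fin k) (𝔴 : PrimeSpectrum (chartRing c j)) (χ : chartRing c j →+* X'.presheaf.stalk x'),
      (∀ a, χ (chartBase c j a) = (π.stalkMap x').hom a) ∧
      @IsLocalization.AtPrime _ _ (X'.presheaf.stalk x') _ χ.toAlgebra 𝔴.asIdeal _ ∧
      𝔴.asIdeal.comap (chartBase c j) = maximalIdeal (X.presheaf.stalk (π x')) := by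
  obtain ⟨j, w, q, hq, hiso, hsq⟩ := exists_chart_morphism_of_span_singleton_mul hπ x' c γ hγ hc0 hc
  haveI := hiso
  obtain ⟨χ, h1, h2, h3⟩ := exists_stalk_ringHom_of_chart π x' _ q w hq hsq
  exact ⟨j, w, χ, h1, h2, h3⟩

end Stalks

/-- ★★ **THE STALKS OF A BLOWING UP ALONG `γ·(a, b)` ARE COHEN–MACAULAY**: `X` integral, `π : X′ → X` a blowing up along `J`, `x′ ∈ X′` with
`R = 𝒪_{X,π x′}` REGULAR, `γ ≠ 0`, `(a, b)` AND `(b, a)` weakly regular on `R` (e.g. `a, b` coprime nonzero elements, transported from a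
UFD model along a flat leg), `J_{π x′} = γ·(a, b)` ⇒ `CMCl 𝒪_{X′,x′}`. (F4(c) of the Ω₁ global patch at every point over `supp 𝒥`; no chart
tables, no restriction to affine opens.) [OURS; cite: StacksProject, Tag 0804, Tag 0BIQ; Matsumura1987, Thm. 17.4 (iii)] -/
theorem cmCl_stalk_of_isBlowup_pair {X' X : Scheme.{0}} {π : X' ⟶ X} {J : X.IdealSheafData} [IsIntegral X]
    (hπ : IsBlowup π J) (x' : X') (hR : IsRegularLocalRing (X.presheaf.stalk (π x')))
    (γ a b : X.presheaf.stalk (π x')) (hγ : γ ≠ 0)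
    (hab : IsWeaklyRegular (X.presheaf.stalk (π x')) [a, b]) (hba : IsWeaklyRegular (X.presheaf.stalk (π x')) [b, a])
    (hJ : Ideal.span {γ} * Ideal.span {a, b} = stalkIdeal J (π x')) :
    CMCl (X'.presheaf.stalk x') := by
  haveI := hR
  obtain ⟨ha, hab'⟩ := pair_of_isWeaklyRegular hab
  obtain ⟨hb, hba'⟩ := pair_of_isWeaklyRegular hba
  have hc : Ideal.span {γ} * Ideal.span (Set.range ![a, b]) = stalkIdeal J (π x') := by
    rw [range_vecCons_pair]; exact hJ
  have hc0 : Ideal.span (Set.range ![a, b]) ≠ ⊥ := by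
    rw [range_vecCons_pair]
    exact fun h => nonZeroDivisors.ne_zero ha ((Ideal.span_eq_bot.mp h) a (Set.mem_insert a {b}))
  obtain ⟨j, 𝔴, χ, -, hloc, -⟩ := exists_reesChart_stalk_of_span_singleton_mul hπ x' ![a, b] γ hγ hc0 hc
  letI := χ.toAlgebra
  haveI : IsLocalization.AtPrime (X'.presheaf.stalk x') 𝔴.asIdeal := hloc
  fin_cases j
  · exact cmCl_of_isLocalization_chartRing_pair ![a, b] (j' := 1) (by decide) (by simpa using ha) (by simpa using hab') 𝔴.asIdeal
      (X'.presheaf.stalk x')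
  · exact cmCl_of_isLocalization_chartRing_pair ![a, b] (j' := 0) (by decide) (by simpa using hb) (by simpa using hba') 𝔴.asIdeal
      (X'.presheaf.stalk x')

end Summit.ResolutionOfSingularities.ResolutionOfSingularities.Theorems.FInjectiveMacaulayfication.BlowupPairStalkCM

end
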